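import Summits.NavierStokesRegularity.NavierStokesRegularity.Theorems.PerpetualPumpCircuitPumpClockBoxWindowLemmas

/-!
# `PerpetualPump.CircuitPump` (stmt-NavierStokesRegularity-1834), line `singular-clock-gspt`:
# window numerics of the Toda clock box

Sub-goal `toda_clockBox_window` of `stub_clockBox` (Toda `m = 2` instance). With `q = lam^{1/5}`,
`ν = lam^{4/5}`, `Λ = -log ε`, `A⋆ = (q+1)Λ/(2(q-1))`, the amplitude window `[A₁, A₂] = [0.9A⋆, 1.1A⋆]`
and the explicit section-time window `T₁ = t₃ + Δ⁻`, `T₂ = t₃ + Δ⁺` of `toda_active_clock`, we check,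
under the single largeness hypothesis `100000 (log A₂ + 500) ≤ Λ`: continuity of `T₁, T₂` on
`[A₁, A₂]`, the ordering `0 < Tmin ≤ T₁ ≤ T₂ ≤ Tmax ≤ 1/8`, and the pointwise numerics (no-second-hop
margin `lam W⁺ (Tmax - t₃) ≤ 0.9 Λ`, pre-gate budget `lam (A+4) t₃ ≤ 0.85 Λ`,
`lam W⁺ Δ⁺ ≤ 0.55 Λ + 100`, covering margin). The key sizes: `μ = Λ/A⋆ = 2(q-1)/(q+1) ≤ 0.0811`,
`x = (ℓ₁ + 11/5)/A ≤ 0.0451`, `y⁺ = ν c⁺/(lam W⁻) ≤ 0.0473`, and `x ≤ -log(1-x) ≤ x/(1-x)`.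
Pure real analysis. [folklore]
-/

set_option linter.dupNamespace false

noncomputable section

open Set

namespace Summit.NavierStokesRegularity.NavierStokesRegularity.Theorems.PerpetualPumpCircuitPump

/-- **WINDOW NUMERICS of the Toda clock box.** With `q = lam^{1/5}`, `ν = lam^{4/5}`, `Λ = −log ε`,
`A⋆ = (q+1)Λ/(2(q−1))` (the fixed point of the affine clock `A ↦ qA − (q+1)Λ/2`), amplitude window
`[A₁, A₂] = [9A⋆/10, 11A⋆/10]`, and the explicit section-time window
`T₁(A) = t₃(A) + Δ⁻(A)`, `T₂(A) = t₃(A) + Δ⁺(A)` of `toda_active_core`/`toda_active_clock`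
(`ℓ₁ = Λ/2 + log(A/8)`, `t₃ = −log(1 − (ℓ₁ + 11/5)/A) + (250 + 16 log A)/A`,
`W^∓ = A − ℓ₁ ∓ (903 + 50 log A)`, `Δ^∓` the explicit logs), `Tmax := ` the value of the `T₂`-pieces
bounded at `A₁`/`A₂`, `Tmin := 250/A₂`: for `Λ` large (one explicit largeness hypothesis) the window is
well formed (`WindowOK`: continuity, `0 < Tmin ≤ T₁ ≤ T₂ ≤ Tmax ≤ 1/8`) and the pointwise facts the
bootstrap needs hold on `[A₁, A₂]`, notably the NO-SECOND-HOP MARGIN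
`lam W⁺(A)(Tmax − t₃(A)) ≤ 0.9 Λ` and the pre-gate budget `lam (A+4) t₃(A) ≤ 0.85 Λ`. -/
theorem toda_clockBox_window :
    ∀ (lam ν q ε Λ As A₁ A₂ : ℝ),
    1 < lam → lam ≤ 3 / 2 → ν = lam ^ (4 / 5 : ℝ) → q = lam ^ (1 / 5 : ℝ) → 0 < ε → Λ = -Real.log ε →
    As = (q + 1) * Λ / (2 * (q - 1)) → A₁ = 9 / 10 * As → A₂ = 11 / 10 * As → 40000 ≤ A₁ →
    100000 * (Real.log A₂ + 500) ≤ Λ →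
    (ContinuousOn (fun A : ℝ => (((-Real.log (1 - (((Λ) / 2 + Real.log (A / 8)) + 11 / 5) / A)) + (250 + 16 * Real.log A) / A) + (-(1 / ν) * Real.log (1 - ν * ((Λ) / 2 - Real.log q - 28 * Real.log A - 449) / (lam * (A - ((Λ) / 2 + Real.log (A / 8)) + 903 + 50 * Real.log A)))))) (Set.Icc A₁ A₂) ∧
      ContinuousOn (fun A : ℝ => (((-Real.log (1 - (((Λ) / 2 + Real.log (A / 8)) + 11 / 5) / A)) + (250 + 16 * Real.log A) / A) + (-(1 / ν) * Real.log (1 - ν * ((Λ) / 2 - Real.log q + 73) / (lam * (A - ((Λ) / 2 + Real.log (A / 8)) - 903 - 50 * Real.log A)))))) (Set.Icc A₁ A₂)) ∧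
    0 < (250 / A₂) ∧ (-Real.log (1 - (((Λ) / 2 + Real.log (A₂ / 8)) + 11 / 5) / A₁) + (250 + 16 * Real.log A₂) / A₁ + (-(1 / ν) * Real.log (1 - ν * ((Λ) / 2 - Real.log q + 73) / (lam * (A₁ - ((Λ) / 2 + Real.log (A₁ / 8)) - 903 - 50 * Real.log A₁))))) ≤ 1 / 8 ∧
    (∀ A ∈ Set.Icc A₁ A₂,
      (250 / A₂) ≤ (((-Real.log (1 - (((Λ) / 2 + Real.log (A / 8)) + 11 / 5) / A)) + (250 + 16 * Real.log A) / A) + (-(1 / ν) * Real.log (1 - ν * ((Λ) / 2 - Real.log q - 28 * Real.log A - 449) / (lam * (A - ((Λ) / 2 + Real.log (A / 8)) + 903 + 50 * Real.log A))))) ∧ (((-Real.log (1 - (((Λ) / 2 + Real.log (A / 8)) + 11 / 5) / A)) + (250 + 16 * Real.log A) / A) + (-(1 / ν) * Real.log (1 - ν * ((Λ) / 2 - Real.log q - 28 * Real.log A - 449) / (lam * (A - ((Λ) / 2 + Real.log (A / 8)) + 903 + 50 * Real.log A))))) ≤ (((-Real.log (1 - (((Λ) / 2 + Real.log (A / 8))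 + 11 / 5) / A)) + (250 + 16 * Real.log A) / A) + (-(1 / ν) * Real.log (1 - ν * ((Λ) / 2 - Real.log q + 73) / (lam * (A - ((Λ) / 2 + Real.log (A / 8)) - 903 - 50 * Real.log A))))) ∧ (((-Real.log (1 - (((Λ) / 2 + Real.log (A / 8)) + 11 / 5) / A)) + (250 + 16 * Real.log A) / A) + (-(1 / ν) * Real.log (1 - ν * ((Λ) / 2 - Real.log q + 73) / (lam * (A - ((Λ) / 2 + Real.log (A / 8)) - 903 - 50 * Real.log A))))) ≤ (-Real.log (1 - (((Λ) / 2 + Real.log (A₂ / 8)) + 11 / 5) / A₁) + (250 + 16 * Real.log A₂) / A₁ + (-(1 / ν) * Real.log (1 - ν * ((Λ) / 2 - Real.log q + 73) / (lam * (A₁ - ((Λ) / 2 + Real.log (A₁ / 8)) - 903 - 50 * Real.log A₁)))))) ∧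
    (∀ A ∈ Set.Icc A₁ A₂,
      40000 ≤ A ∧ Λ ≤ A / 5 ∧ ε * (A + 2) ^ 2 ≤ 1 ∧ Real.sqrt ε * A ≤ 1 / 40 ∧
      10 ≤ Real.log A ∧ Real.log A ≤ Real.log A₂ ∧
      0 < (-(1 / ν) * Real.log (1 - ν * ((Λ) / 2 - Real.log q - 28 * Real.log A - 449) / (lam * (A - ((Λ) / 2 + Real.log (A / 8)) + 903 + 50 * Real.log A)))) ∧
      lam * (A - ((Λ) / 2 + Real.log (A / 8)) + 903 + 50 * Real.log A) * ((-Real.log (1 - (((Λ) / 2 + Real.log (A₂ / 8)) + 11 / 5) / A₁) + (250 + 16 * Real.log A₂) / A₁ + (-(1 / ν) * Real.log (1 - ν * ((Λ) / 2 - Real.log q + 73) / (lam * (A₁ - ((Λ) / 2 + Real.log (A₁ / 8)) - 903 - 50 * Real.log A₁))))) - ((-Real.log (1 - (((Λ) / 2 + Real.log (A / 8)) + 11 / 5) / A)) + (250 + 16 * Real.log A) / A)) ≤ 9 / 10 * Λ ∧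
      lam * (A + 4) * ((-Real.log (1 - (((Λ) / 2 + Real.log (A / 8)) + 11 / 5) / A)) + (250 + 16 * Real.log A) / A) ≤ 17 / 20 * Λ ∧
      lam * (A - ((Λ) / 2 + Real.log (A / 8)) + 903 + 50 * Real.log A) * (-(1 / ν) * Real.log (1 - ν * ((Λ) / 2 - Real.log q + 73) / (lam * (A - ((Λ) / 2 + Real.log (A / 8)) - 903 - 50 * Real.log A)))) ≤ 11 / 20 * Λ + 100 ∧
      1500 + 85 * Real.log A < 1 / 10 * (q - 1) * As) := by
  intro lam ν q ε Λ As A₁ A₂ hlam hlam2 hν hq hε hΛ hAs hA₁ hA₂ h40000 HBIG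
  obtain ⟨hν1, -, -, -, -, hlq0, hlq1⟩ := activeClock_consts hlam hlam2 hν hq
  obtain ⟨hq1, -, hAs0, hΛ0, hΛAs, hrel, hA₁0, hA₁₂, hLA₂, hνlam⟩ :=
    clockBox_consts hlam hlam2 hν hq hAs hA₁ hA₂ h40000 HBIG
  have hlam0 : 0 < lam := zero_lt_one.trans hlam
  have hν0 : 0 < ν := zero_lt_one.trans hν1
  have hA₂0 : 0 < A₂ := hA₁0.trans_le hA₁₂
  obtain ⟨μ, hμ, hμ0, hμ1⟩ : ∃ μ : ℝ, Λ = μ * As ∧ 0 < μ ∧ μ ≤ 811 / 10000 :=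
    ⟨Λ / As, by field_simp, div_pos hΛ0 hAs0, by rwa [div_le_iff₀ hAs0]⟩
  -- window membership gives the primitive sizes
  have hw : ∀ A ∈ Set.Icc A₁ A₂, 9 / 10 * As ≤ A ∧ A ≤ 11 / 10 * As ∧ 40000 ≤ A ∧
      Real.log A ≤ Λ / 100000 - 500 := fun A hA =>
    ⟨by rw [← hA₁]; exact hA.1, by rw [← hA₂]; exact hA.2, h40000.trans hA.1,
      (Real.log_le_log (hA₁0.trans_le hA.1) hA.2).trans hLA₂⟩
  obtain ⟨hw1₁, hw2₁, hw3₁, hw4₁⟩ := hw A₁ ⟨le_rfl, hA₁₂⟩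
  obtain ⟨-, -, -, -, -, -, hWm₁, -, -, hcp₁, hcW₁, -, -⟩ :=
    clockBox_point _ _ _ _ _ hlq0 hlq1 hAs0 hμ hμ0 hμ1 hw1₁ hw2₁ hw3₁ hw4₁
  obtain ⟨hw1₂, hw2₂, hw3₂, hw4₂⟩ := hw A₂ ⟨hA₁₂, le_rfl⟩
  obtain ⟨hL₂, h8₂, h8'₂, -, -, -, -, -, -, -, -, -, hπn₂⟩ :=
    clockBox_point _ _ _ _ _ hlq0 hlq1 hAs0 hμ hμ0 hμ1 hw1₂ hw2₂ hw3₂ hw4₂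
  have hΛbig : 50000000 ≤ Λ := by linarith only [hL₂, hLA₂]
  have hcp0 : 0 ≤ Λ / 2 - Real.log q + 73 := by linarith only [hlq1, hΛ0]
  -- the pieces of `Tmax`
  have hWm₁0 : 0 < A₁ - (Λ / 2 + Real.log (A₁ / 8)) - 903 - 50 * Real.log A₁ := by
    linarith only [hWm₁, hAs0]
  obtain ⟨hy₁, -, hΔ₁, hcw₁, -⟩ := clockBox_delta hν1.le hνlam hWm₁0 hcp0 hcW₁
  have hxs0 : 0 ≤ ((Λ / 2 + Real.log (A₂ / 8)) + 11 / 5) / A₁ :=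
    div_nonneg (by linarith only [hΛ0, h8₂]) hA₁0.le
  have hxs1 : ((Λ / 2 + Real.log (A₂ / 8)) + 11 / 5) / A₁ ≤ 5556 / 10000 * μ := by
    rw [div_le_iff₀ hA₁0]
    have e : 5556 / 10000 * μ * A₁ = 50004 / 100000 * Λ := by rw [hμ, hA₁]; ring
    rw [e]; linarith only [h8'₂, hLA₂, hΛ0]
  have hxs2 : ((Λ / 2 + Real.log (A₂ / 8)) + 11 / 5) / A₁ ≤ 451 / 10000 := by
    linarith only [hxs1, mul_le_mul_of_nonneg_left hμ1 (by norm_num : (0 : ℝ) ≤ 5556 / 10000)]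
  obtain ⟨hτs0, -, hτs⟩ := clockBox_tau hxs0 hxs2
  have hτs' : -Real.log (1 - ((Λ / 2 + Real.log (A₂ / 8)) + 11 / 5) / A₁) ≤ 5819 / 10000 * μ := by
    linarith only [hτs, hxs1, hμ0]
  have hπs1 : (250 + 16 * Real.log A₂) / A₁ ≤ 2 / 10000 * μ := by
    rw [div_le_iff₀ hA₁0]
    have e : 2 / 10000 * μ * A₁ = 18 / 100000 * Λ := by rw [hμ, hA₁]; ring
    rw [e]; linarith only [hπn₂, hΛ0]
  refine ⟨⟨?_, ?_⟩, by positivity, ?_, ?_⟩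
  · -- continuity of `T₁`
    intro A hA
    obtain ⟨hw1, hw2, hw3, hw4⟩ := hw A hA
    obtain ⟨hL, -, -, -, -, hx3, hWm, -, hcm, -, hcW, -, -⟩ :=
      clockBox_point _ _ _ _ _ hlq0 hlq1 hAs0 hμ hμ0 hμ1 hw1 hw2 hw3 hw4
    have hWp0 : 0 < A - (Λ / 2 + Real.log (A / 8)) + 903 + 50 * Real.log A := by
      linarith only [hWm, hAs0, hL]
    have hcW' : Λ / 2 - Real.log q - 28 * Real.log A - 449 ≤
        473 / 10000 * (A - (Λ / 2 + Real.log (A / 8)) + 903 + 50 * Real.log A) := by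
      linarith only [hcW, hL, hWm, hAs0]
    obtain ⟨hy, -⟩ := clockBox_delta hν1.le hνlam hWp0 hcm.le hcW'
    have h1 : A ≠ 0 := (hA₁0.trans_le hA.1).ne'
    have h2 : A / 8 ≠ 0 := by positivity
    have h3 : 1 - ((Λ / 2 + Real.log (A / 8)) + 11 / 5) / A ≠ 0 := by
      apply ne_of_gt; linarith only [hx3]
    have h4 : lam * (A - (Λ / 2 + Real.log (A / 8)) + 903 + 50 * Real.log A) ≠ 0 := by positivity
    have h5 : 1 - ν * (Λ / 2 - Real.log q - 28 * Real.log A - 449) /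
        (lam * (A - (Λ / 2 + Real.log (A / 8)) + 903 + 50 * Real.log A)) ≠ 0 := by
      apply ne_of_gt; linarith only [hy]
    exact (clockBox_cont1 h1 h2 h3 h4 h5).continuousWithinAt
  · -- continuity of `T₂`
    intro A hA
    obtain ⟨hw1, hw2, hw3, hw4⟩ := hw A hA
    obtain ⟨hL, -, -, -, -, hx3, hWm, -, hcm, -, hcW, -, -⟩ :=
      clockBox_point _ _ _ _ _ hlq0 hlq1 hAs0 hμ hμ0 hμ1 hw1 hw2 hw3 hw4
    have hWm0 : 0 < A - (Λ / 2 + Real.log (A / 8)) - 903 - 50 * Real.log A := by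
      linarith only [hWm, hAs0]
    obtain ⟨hy, -⟩ := clockBox_delta hν1.le hνlam hWm0 hcp0 hcW
    have h1 : A ≠ 0 := (hA₁0.trans_le hA.1).ne'
    have h2 : A / 8 ≠ 0 := by positivity
    have h3 : 1 - ((Λ / 2 + Real.log (A / 8)) + 11 / 5) / A ≠ 0 := by
      apply ne_of_gt; linarith only [hx3]
    have h4 : lam * (A - (Λ / 2 + Real.log (A / 8)) - 903 - 50 * Real.log A) ≠ 0 := by positivity
    have h5 : 1 - ν * (Λ / 2 - Real.log q + 73) /
        (lam * (A - (Λ / 2 + Real.log (A / 8)) - 903 - 50 * Real.log A)) ≠ 0 := by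
      apply ne_of_gt; linarith only [hy]
    exact (clockBox_cont2 h1 h2 h3 h4 h5).continuousWithinAt
  · -- `Tmax ≤ 1/8`
    have := mul_le_mul_of_nonneg_left hcw₁ (by norm_num : (0 : ℝ) ≤ 10497 / 10000)
    linarith only [this, hτs, hxs2, hπs1, hμ1, hΔ₁]
  · -- the window chain and the pointwise numerics, for `A ∈ [A₁, A₂]`
    refine forall_and.mp fun A => imp_and.mp fun hA => ?_
    obtain ⟨hw1, hw2, hw3, hw4⟩ := hw A hA
    have hA0 : 0 < A := hA₁0.trans_le hA.1
    obtain ⟨hL, h8, h8', hx1, hx2, hx3, hWm, hWp, hcm, hcp, hcW, hJ, hπn⟩ :=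
      clockBox_point _ _ _ _ _ hlq0 hlq1 hAs0 hμ hμ0 hμ1 hw1 hw2 hw3 hw4
    have hWm0 : 0 < A - (Λ / 2 + Real.log (A / 8)) - 903 - 50 * Real.log A := by
      linarith only [hWm, hAs0]
    have hWp0 : 0 < A - (Λ / 2 + Real.log (A / 8)) + 903 + 50 * Real.log A := by
      linarith only [hWm, hAs0, hL]
    have hWmp : A - (Λ / 2 + Real.log (A / 8)) - 903 - 50 * Real.log A ≤
        A - (Λ / 2 + Real.log (A / 8)) + 903 + 50 * Real.log A := by linarith only [hL]
    have hcmp : Λ / 2 - Real.log q - 28 * Real.log A - 449 ≤ Λ / 2 - Real.log q + 73 := by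
      linarith only [hL]
    obtain ⟨hyp, -, hΔp, hcw, -⟩ := clockBox_delta hν1.le hνlam hWm0 hcp0 hcW
    obtain ⟨-, -, -, -, hΔmpos⟩ :=
      clockBox_delta hν1.le hνlam hWp0 hcm.le (by linarith only [hWmp, hcmp, hcW])
    have hΔm := hΔmpos hcm
    obtain ⟨hτ0, hxτ, hτ⟩ := clockBox_tau (le_trans (by positivity) hx1) hx3
    have hπ0 : 0 ≤ (250 + 16 * Real.log A) / A := div_nonneg (by linarith only [hL]) hA0.le
    have hπ1 : 250 / A₂ ≤ (250 + 16 * Real.log A) / A :=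
      (div_le_div_of_nonneg_left (by norm_num) hA0 hA.2).trans
        (div_le_div_of_nonneg_right (by linarith only [hL]) hA0.le)
    -- monotonicity in `A` of the three pieces of `T₂`
    have hl8 : Real.log (A / 8) ≤ Real.log (A₂ / 8) :=
      Real.log_le_log (by positivity) (div_le_div_of_nonneg_right hA.2 (by norm_num))
    have hlA : Real.log A ≤ Real.log A₂ := Real.log_le_log hA0 hA.2
    have hxx : ((Λ / 2 + Real.log (A / 8)) + 11 / 5) / A ≤
        ((Λ / 2 + Real.log (A₂ / 8)) + 11 / 5) / A₁ :=
      div_le_div₀ (by linarith only [hΛ0, h8₂]) (by linarith only [hl8]) hA₁0 hA.1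
    have hτle := clockBox_neglog_mono hxx (by linarith only [hxs2])
    have hπle : (250 + 16 * Real.log A) / A ≤ (250 + 16 * Real.log A₂) / A₁ :=
      div_le_div₀ (by linarith only [hL₂]) (by linarith only [hlA]) hA₁0 hA.1
    have hWW := clockBox_Wmono (Λ := Λ) (show (51 : ℝ) ≤ A₁ by linarith only [h40000]) hA.1
    have hyy := div_le_div_of_nonneg_left (mul_nonneg hν0.le hcp0) (mul_pos hlam0 hWm₁0)
      (mul_le_mul_of_nonneg_left hWW hlam0.le)
    have hΔle := clockBox_delta_mono hν0 hyy hy₁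
    have hyy' := div_le_div₀ (mul_nonneg hν0.le hcp0) (mul_le_mul_of_nonneg_left hcmp hν0.le)
      (mul_pos hlam0 hWm0) (mul_le_mul_of_nonneg_left hWmp hlam0.le)
    have hΔmp := clockBox_delta_mono hν0 hyy' hyp
    refine ⟨⟨by linarith only [hπ1, hτ0, hΔm], by linarith only [hΔmp],
      by linarith only [hτle, hπle, hΔle]⟩, hw3, by linarith only [hΛAs, hw1, hAs0],
      (clockBox_eps hε hΛ hw3 hw4).1, (clockBox_eps hε hΛ hw3 hw4).2, hL, hlA, hΔm, ?_, ?_, ?_, ?_⟩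
    · -- no-second-hop margin
      exact clockBox_nhop hlam hlam2 hAs0 hμ hμ0 hWp0 hWp hτs' hπs1 hxτ hx1 hπ0 hΔ₁ hWm₁ hcp0 hcp₁
    · -- pre-gate budget
      have hxA : ((Λ / 2 + Real.log (A / 8)) + 11 / 5) / A * A ≤ 50001 / 100000 * Λ := by
        rw [div_mul_cancel₀ _ hA0.ne']; linarith only [h8', hw4]
      have hπA : (250 + 16 * Real.log A) / A * A ≤ 16 / 100000 * Λ := by
        rw [div_mul_cancel₀ _ hA0.ne']; exact hπn
      exact clockBox_pregate hlam2 hw3 hx3 hτ0 hτ hxA hπ0 hπA hΛbig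
    · -- `lam W⁺ Δ⁺ ≤ 0.55 Λ + 100`
      rw [show A - (Λ / 2 + Real.log (A / 8)) + 903 + 50 * Real.log A =
        (A - (Λ / 2 + Real.log (A / 8)) - 903 - 50 * Real.log A) + (1806 + 100 * Real.log A) by ring]
      exact clockBox_wdelta hlam0 hAs0 hΛAs hΛ0.le hWm (by linarith only [hL]) hJ hcp0
        (by linarith only [hlq0]) hΔp
    · -- covering margin
      have e : 1 / 10 * (q - 1) * As = (q + 1) * Λ / 20 := by rw [mul_assoc, hrel]; ring
      rw [e]
      linarith only [mul_nonneg (sub_nonneg.mpr hq1.le) hΛ0.le, hw4, hL, hΛ0]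

end Summit.NavierStokesRegularity.NavierStokesRegularity.Theorems.PerpetualPumpCircuitPump
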